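import Literature.Probability.RandomPlanarGeometry.SLERestrictionDerivMeasurable
import Literature.Probability.RandomPlanarGeometry.SLEKappaRhoTranslates
import Literature.Probability.RandomPlanarGeometry.SLEKappaRhoLoewnerRepr
import Literature.Probability.RandomPlanarGeometry.SLEKappaRhoSlidArc
import Literature.Probability.Process.BrownianVec
import HarnessLib

/-!
# `ω ↦ Φ'_{B(ω)}(0)` is measurable for random `*`-hulls with measurable dense points; translates of slid hulls

G. F. Lawler, O. Schramm, W. Werner, *Conformal restriction: the chordal case*, J. Amer. Math.
Soc. **16** (2003) 917–955 (**[LSW]**), §8.4: the one-sided martingale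
`M_t = h_t'(W_t)^{5/8} h_t'(O_t)^b [(h_t(W_t) − h_t(O_t))/(W_t − O_t)]^c` is (implicitly) a process
adapted to the Brownian filtration. With `h_t'(x + W_t) = Φ'_{B_t − x}(0)` (`hullDeriv_translate`,
`B_t = A_t − W_t` the slid hull) all three factors are functionals of the RESTRICTION DERIVATIVES OF
THE TRANSLATES `B_t − x`, `x ≤ 0`, of the slid hull. This file proves their measurability in the
sample, generalising the tree's `Loewner.measurable_indicator_starDeriv_slidHull` (the case `x = 0`)
and complementing `TranslatedHullJets` (`Loewner.measurable_indicator_starDeriv_translate_slidHull`: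
small translates `|x| < dist(0, B_t)` of `*`-hulls) by ALL translates `x ≤ 0` of `+`-hulls:

* `measurable_starDeriv_of_denseSeq` — **abstract form**: if `b_k : Ω → ℂ` are measurable, with
  bounded range along each sample, valued and dense in a nonempty `*`-hull `H(ω)`, then
  `ω ↦ Φ'_{H(ω)}(0)` is measurable (dyadic outer hulls of the finite configurations of the
  `b_k(ω)`, measurable as maps into the countable set of configurations, and
  `tendsto_starDeriv_outerHull`);
* `Loewner.measurable_indicator_starDeriv_translate_slidHull_of_nonpos` — for a family of continuous driving
  functions from `0` with measurable values up to time `t`, a nonempty `A ∈ 𝒬₊` and a real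
  `x ≤ 0`: `ω ↦ Φ'_{(A_t − W_t) − x}(0) · 𝟙{alive}` is measurable (the translated slid points
  `g_t(a_k) − W_t − x` are measurable, bounded and dense in the translate, which is a `*`-hull as
  the slid hull is in `𝒬₊`, `Loewner.isPlusHull_slidHull_of_disjoint`);
* `Loewner.measurable_indicator_starDeriv_translate_slidHull_comp` — the same with a RANDOM
  measurable translate `o(ω) ≤ 0` (e.g. `o = O_t − W_t`): joint measurability in `(x, ω)` from
  continuity in `x` (`measurable_uncurry_of_continuous_of_measurable`);
* `Loewner.measurable_indicator_re_starMap_slidHull_comp` — **`ω ↦ E_{B_t(ω)}(o(ω))`** (i.e.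
  `h_t(O_t) − h_t(W_t)`) is measurable: `E_B(o) = −∫_o^0 E_B'` is the limit of Riemann sums of the
  previous random variables (`tendsto_riemannSum_starDeriv_translate`);
* `Loewner.measurable_indicator_re_deriv2_starMap_slidHull_comp` — **`ω ↦ E_{B_t(ω)}''(o(ω))`** is
  measurable: the limit of difference quotients of `y ↦ E_B'(y) = Φ'_{B−y}(0)`
  (`hasDerivAt_re_deriv_starMap`, `tendsto_slope_starDeriv_translate_left`).

Together with the tree's `measurable_indicator_starJet2_slidHull` / `…starJet3…` (`E_{B_t}''(0)`,
`E_{B_t}'''(0)`) these are all the hull functionals entering `M_t` and the jets of `log M_t`.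

No named facts.

## References

* [LSW] §8.4 (definition of `M_t`), §5 (`h_t`, `A_t`). [LawlerSchrammWerner2003Restriction]
-/

noncomputable section

open Set Filter MeasureTheory Metric
open scoped NNReal Topology

namespace Literature.Probability.RandomPlanarGeometry

/-! ### The abstract form -/

section Abstract

variable {Ω : Type*} {mΩ : MeasurableSpace Ω} {b : ℕ → Ω → ℂ}

/-- The finite dyadic configuration of a bounded measurable sequence of random points. [folklore] -/
def ptConfig (hbdd : ∀ ω, Bornology.IsBounded (range fun k ↦ b k ω)) (n : ℕ) (ω : Ω) : Finset (ℤ × ℤ) :=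
  (finite_outerConfig (hbdd ω) n).toFinset

/-- The configuration as a set is `outerConfig` of the points. [folklore] -/
theorem coe_ptConfig (hbdd : ∀ ω, Bornology.IsBounded (range fun k ↦ b k ω)) (n : ℕ) (ω : Ω) :
    (ptConfig hbdd n ω : Set (ℤ × ℤ)) = outerConfig (fun k ↦ b k ω) n :=
  Finite.coe_toFinset _

/-- **The configuration map is measurable** into the countable set of finite configurations with
its discrete σ-algebra. [folklore] -/
theorem measurable_ptConfig (hb : ∀ k, Measurable (b k)) (hbdd : ∀ ω, Bornology.IsBounded (range fun k ↦ b k ω)) (n : ℕ) :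
    Measurable[mΩ, (⊤ : MeasurableSpace (Finset (ℤ × ℤ)))] (ptConfig hbdd n) := by
  have hE : ∀ p : ℤ × ℤ, MeasurableSet {ω | p ∈ outerConfig (fun k ↦ b k ω) n} := by
    intro p
    have : {ω | p ∈ outerConfig (fun k ↦ b k ω) n} = ⋃ k, {ω | infDist (b k ω) (dyadicSquare n p.1 p.2) < 1 / 2 ^ n} := by
      ext ω; simp [outerConfig]
    rw [this]
    exact MeasurableSet.iUnion fun k ↦ measurableSet_lt
      ((continuous_infDist_pt (s := dyadicSquare n p.1 p.2)).measurable.comp (hb k)) measurable_const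
  refine @measurable_to_countable' _ _ ⊤ _ _ _ fun F ↦ ?_
  have : ptConfig hbdd n ⁻¹' {F} = ⋂ p : ℤ × ℤ, {ω | p ∈ outerConfig (fun k ↦ b k ω) n ↔ p ∈ F} := by
    ext ω
    simp only [mem_preimage, mem_singleton_iff, mem_iInter, mem_setOf_eq]
    rw [← Finset.coe_inj, coe_ptConfig, Set.ext_iff]
    simp only [Finset.mem_coe]
  rw [this]
  refine MeasurableSet.iInter fun p ↦ ?_
  by_cases hp : p ∈ F
  · simp only [hp, iff_true]; exact hE p
  · simp only [hp, iff_false]; exact (hE p).compl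

/-- **`ω ↦ Φ'_{H(ω)}(0)` is measurable on the event where `H(ω)` is a nonempty `*`-hull in which
the measurable bounded points `b_k(ω) ∈ H(ω)` are dense** (value `0` elsewhere).
[cite: LawlerSchrammWerner2003Restriction, §8.4 (M_t as a process)] -/
theorem measurable_indicator_starDeriv_of_denseSeq {H : Ω → Set ℂ} (hb : ∀ k, Measurable (b k))
    (hbdd : ∀ ω, Bornology.IsBounded (range fun k ↦ b k ω)) {E : Set Ω} (hE : MeasurableSet E)
    (hmem : ∀ ω ∈ E, ∀ k, b k ω ∈ H ω) (hdense : ∀ ω ∈ E, H ω ⊆ closure (range fun k ↦ b k ω))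
    (hstar : ∀ ω ∈ E, IsStarHull (H ω)) (hne : ∀ ω ∈ E, (H ω).Nonempty) :
    Measurable fun ω ↦ E.indicator (fun ω ↦ starDeriv (H ω)) ω := by
  classical
  set G : ℕ → Ω → ℝ := fun n ω ↦ starDeriv (outerHull n (ptConfig hbdd n ω : Set (ℤ × ℤ))) with hG
  have hGm : ∀ n, Measurable (G n) := fun n ↦
    (@measurable_from_top _ _ _ (f := fun F : Finset (ℤ × ℤ) ↦ starDeriv (outerHull n (F : Set (ℤ × ℤ))))).comp
      (measurable_ptConfig hb hbdd n)
  have hGm' : ∀ n, Measurable fun ω ↦ E.indicator (G n) ω := fun n ↦ (hGm n).indicator hE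
  refine measurable_of_tendsto_metrizable hGm' (tendsto_pi_nhds.2 fun ω ↦ ?_)
  by_cases hω : ω ∈ E
  · simp only [Set.indicator_of_mem hω]
    have := tendsto_starDeriv_outerHull (hstar ω hω) (hne ω hω) (hmem ω hω) (hdense ω hω)
    simp only [hG, coe_ptConfig]
    exact this
  · simp only [Set.indicator_of_notMem hω]
    exact tendsto_const_nhds

end Abstract

/-! ### Translates of slid hulls -/

namespace Loewner

variable {Ω : Type*} {mΩ : MeasurableSpace Ω} {W : Ω → ℝ≥0 → ℝ} {A : Set ℂ} {t : ℝ≥0}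

/-- The translate of a set is the image under the homeomorphism `z ↦ z − x`; dense sequences stay
dense. [folklore] -/
theorem translate_subset_closure_range {B : Set ℂ} {b : ℕ → ℂ} (hd : B ⊆ closure (range b)) (x : ℝ) :
    SLEKappaRho.translate B x ⊆ closure (range fun k ↦ b k - x) := by
  rintro _ ⟨z, hz, rfl⟩
  have hcont : Continuous fun w : ℂ ↦ w - x := continuous_id.sub continuous_const
  have := mem_closure_image hcont.continuousAt (hd hz)
  rwa [← range_comp] at this

/-- **`ω ↦ Φ'_{(A_t − W_t) − x}(0) · 𝟙{alive}` is measurable** for every real `x ≤ 0` and every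
nonempty `A ∈ 𝒬₊` (so that `h_t'(x + W_t)`, `x ≤ 0`, is a random variable).
[cite: LawlerSchrammWerner2003Restriction, §8.4 (h_t'(O_t) in M_t)] -/
theorem measurable_indicator_starDeriv_translate_slidHull_of_nonpos (hc : ∀ ω, Continuous (W ω)) (hW0 : ∀ ω, W ω 0 = 0)
    (hmeas : ∀ s, s ≤ t → Measurable fun ω ↦ W ω s) (hA : IsPlusHull A) (hne : A.Nonempty) {x : ℝ} (hx : x ≤ 0) :
    Measurable fun ω ↦ Set.indicator {ω | Disjoint (closedHull (W ω) t) A}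
      (fun ω ↦ starDeriv (SLEKappaRho.translate (slidHull (W ω) A t) x)) ω := by
  classical
  obtain ⟨a, ha, hdense⟩ := exists_denseSeq hA.1 hne
  have hAb : Bornology.IsBounded A := hA.1.isBoundedHull.isCompact.isBounded
  have hEm := measurableSet_disjoint_closedHull hc hW0 hmeas hA.1 hne
  -- the translated slid points
  set b : ℕ → Ω → ℂ := fun k ω ↦ slidPt W a t k ω - x with hb
  have hbm : ∀ k, Measurable (b k) := fun k ↦ (measurable_slidPt hc hmeas (fun k ↦ (ha k).2) k).sub measurable_const
  have hbdd : ∀ ω, Bornology.IsBounded (range fun k ↦ b k ω) := by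
    intro ω
    have h := (isBounded_range_slidPt (t := t) hc hAb ha ω).sub (Bornology.isBounded_singleton (x := (x : ℂ)))
    refine h.subset ?_
    rintro _ ⟨k, rfl⟩
    exact ⟨slidPt W a t k ω, ⟨k, rfl⟩, (x : ℂ), rfl, rfl⟩
  refine measurable_indicator_starDeriv_of_denseSeq (H := fun ω ↦ SLEKappaRho.translate (slidHull (W ω) A t) x) hbm hbdd hEm
    (fun ω _ k ↦ ⟨slidPt W a t k ω, slidPt_mem (fun k ↦ (ha k).1) k ω, rfl⟩)
    (fun ω hω ↦ translate_subset_closure_range (slidHull_subset_closure_range_slidPt (hc ω) hA.1 hdense hω) x)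
    (fun ω hω ↦ ?_) (fun ω hω ↦ ((hne.image _).image _))
  -- the translate of the slid `+`-hull by `x ≤ 0` is a `*`-hull
  have hplus : IsPlusHull (slidHull (W ω) A t) := isPlusHull_slidHull_of_disjoint (hc ω) (hW0 ω) hA hω
  exact SLEKappaRho.isStarHull_translate hplus.1.isBoundedHull (hplus.ofReal_notMem_of_nonpos hx)

/-- Continuity of `x ↦ Φ'_{B − min(x,0)}(0)` for a `+`-hull (it is `Re E_B'` there). [folklore] -/
theorem continuous_starDeriv_translate_min {B : Set ℂ} (hB : IsPlusHull B) :
    Continuous fun x : ℝ ↦ starDeriv (SLEKappaRho.translate B (min x 0)) := by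
  have hcont : ContinuousOn (fun y : ℝ ↦ (deriv (starMap B) y).re) (Iic 0) :=
    (continuousOn_re_deriv_starMap hB.1).mono fun y hy ↦ hB.ofReal_notMem_of_nonpos hy
  have hmin : Continuous fun x : ℝ ↦ min x 0 := continuous_id.min continuous_const
  have h := hcont.comp_continuous hmin fun x ↦ min_le_right x 0
  refine h.congr fun x ↦ ?_
  simp only [Function.comp_apply]
  rw [← hullDeriv_eq_starDeriv, hullDeriv_translate hB.1 (hB.ofReal_notMem_of_nonpos (min_le_right x 0))]

/-- **`ω ↦ Φ'_{(A_t − W_t) − o(ω)}(0) · 𝟙{alive}` is measurable for a measurable `o ≤ 0`** (e.g.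
`o = O_t − W_t`): joint measurability in `(x, ω)` from measurability in `ω` for fixed `x` and
continuity in `x` (`measurable_uncurry_of_continuous_of_measurable`).
[cite: LawlerSchrammWerner2003Restriction, §8.4 (h_t'(O_t) in M_t)] -/
theorem measurable_indicator_starDeriv_translate_slidHull_comp (hc : ∀ ω, Continuous (W ω)) (hW0 : ∀ ω, W ω 0 = 0)
    (hmeas : ∀ s, s ≤ t → Measurable fun ω ↦ W ω s) (hA : IsPlusHull A) (hne : A.Nonempty)
    {o : Ω → ℝ} (ho : Measurable o) (ho0 : ∀ ω, o ω ≤ 0) :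
    Measurable fun ω ↦ Set.indicator {ω | Disjoint (closedHull (W ω) t) A}
      (fun ω ↦ starDeriv (SLEKappaRho.translate (slidHull (W ω) A t) (o ω))) ω := by
  -- the alive indicator as a factor
  have hind : ∀ (f : Ω → ℝ) (ω : Ω), Set.indicator {ω | Disjoint (closedHull (W ω) t) A} f ω =
      Set.indicator {ω | Disjoint (closedHull (W ω) t) A} (fun _ ↦ (1 : ℝ)) ω * f ω := fun f ω ↦ by
    by_cases hω : ω ∈ {ω | Disjoint (closedHull (W ω) t) A}
    · rw [Set.indicator_of_mem hω, Set.indicator_of_mem hω, one_mul]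
    · rw [Set.indicator_of_notMem hω, Set.indicator_of_notMem hω, zero_mul]
  -- the two-parameter family `u x ω = 𝟙{alive}(ω) Φ'_{B_t(ω) − min(x,0)}(0)`
  have huc : ∀ ω, Continuous fun x : ℝ ↦ Set.indicator {ω | Disjoint (closedHull (W ω) t) A} (fun _ ↦ (1 : ℝ)) ω *
      starDeriv (SLEKappaRho.translate (slidHull (W ω) A t) (min x 0)) := by
    intro ω
    by_cases hω : Disjoint (closedHull (W ω) t) A
    · exact continuous_const.mul (continuous_starDeriv_translate_min (isPlusHull_slidHull_of_disjoint (hc ω) (hW0 ω) hA hω))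
    · rw [Set.indicator_of_notMem (show ω ∉ {ω | Disjoint (closedHull (W ω) t) A} from hω)]
      simp only [zero_mul]; exact continuous_const
  have hum : ∀ x : ℝ, Measurable fun ω ↦ Set.indicator {ω | Disjoint (closedHull (W ω) t) A} (fun _ ↦ (1 : ℝ)) ω *
      starDeriv (SLEKappaRho.translate (slidHull (W ω) A t) (min x 0)) := by
    intro x
    have h := measurable_indicator_starDeriv_translate_slidHull_of_nonpos hc hW0 hmeas hA hne (min_le_right x 0)
    have he : (fun ω ↦ Set.indicator {ω | Disjoint (closedHull (W ω) t) A} (fun _ ↦ (1 : ℝ)) ω *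
        starDeriv (SLEKappaRho.translate (slidHull (W ω) A t) (min x 0))) =
        fun ω ↦ Set.indicator {ω | Disjoint (closedHull (W ω) t) A}
          (fun ω ↦ starDeriv (SLEKappaRho.translate (slidHull (W ω) A t) (min x 0))) ω :=
      funext fun ω ↦ (hind (fun ω ↦ starDeriv (SLEKappaRho.translate (slidHull (W ω) A t) (min x 0))) ω).symm
    rw [he]; exact h
  have hj := measurable_uncurry_of_continuous_of_measurable huc hum
  have h := hj.comp (ho.prodMk measurable_id)
  simp only [Function.comp_def, Function.uncurry_apply_pair] at h
  have he : (fun ω ↦ Set.indicator {ω | Disjoint (closedHull (W ω) t) A}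
      (fun ω ↦ starDeriv (SLEKappaRho.translate (slidHull (W ω) A t) (o ω))) ω) =
      fun ω ↦ Set.indicator {ω | Disjoint (closedHull (W ω) t) A} (fun _ ↦ (1 : ℝ)) ω *
        starDeriv (SLEKappaRho.translate (slidHull (W ω) A t) (min (o ω) 0)) := by
    funext ω
    rw [hind (fun ω ↦ starDeriv (SLEKappaRho.translate (slidHull (W ω) A t) (o ω))) ω, min_eq_left (ho0 ω)]
  rw [he]
  exact h

/-! ### The values `E_{B_t}(o)`, `o ≤ 0`, as limits of Riemann sums of restriction derivatives -/

/-- **`E_B(o) = −lim Riemann sums of `y ↦ Φ'_{B−y}(0)` over `[o, 0]`** for a `+`-hull `B` and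
`o ≤ 0` (`E_B(o) = −∫_o^0 E_B'`, `E_B' (y) = Φ'_{B−y}(0)`, `integral_hullDeriv_translate`). [folklore] -/
theorem tendsto_riemannSum_starDeriv_translate {B : Set ℂ} (hB : IsPlusHull B) {o : ℝ} (ho : o ≤ 0) :
    Tendsto (fun n : ℕ ↦ ∑ k ∈ Finset.range n, (0 - o) / n * starDeriv (SLEKappaRho.translate B (o + k * ((0 - o) / n))))
      atTop (𝓝 (-(starMap B o).re)) := by
  rcases ho.lt_or_eq with ho0 | rfl
  · have hcont : ContinuousOn (fun y : ℝ ↦ starDeriv (SLEKappaRho.translate B y)) (Icc o 0) := by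
      have h1 : ContinuousOn (fun y : ℝ ↦ (deriv (starMap B) y).re) (Icc o 0) :=
        (continuousOn_re_deriv_starMap hB.1).mono fun y hy ↦ hB.ofReal_notMem_of_nonpos hy.2
      refine h1.congr fun y hy ↦ ?_
      rw [← hullDeriv_eq_starDeriv, hullDeriv_translate hB.1 (hB.ofReal_notMem_of_nonpos hy.2)]
    have h := Literature.Probability.Process.tendsto_riemannSum_of_continuousOn ho0.le hcont
    have hint : ∫ y in o..0, starDeriv (SLEKappaRho.translate B y) = -(starMap B o).re := by
      rw [← integral_hullDeriv_translate hB.1 ho0 fun y hy ↦ hB.ofReal_notMem_of_nonpos hy.2]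
      exact intervalIntegral.integral_congr fun y _ ↦ (hullDeriv_eq_starDeriv _).symm ▸ rfl
    rwa [hint] at h
  · simp only [sub_self, zero_div, zero_mul, Finset.sum_const_zero, Complex.ofReal_zero, starMap_zero hB.1,
      Complex.zero_re, neg_zero]
    exact tendsto_const_nhds

/-- **`ω ↦ E_{B_t(ω)}(o(ω)) · 𝟙{alive}` is measurable for a measurable `o ≤ 0`** (so that
`h_t(O_t) − h_t(W_t) = E_{B_t}(O_t − W_t)` is a random variable): it is the limit of Riemann sums of
the measurable restriction derivatives of random translates
(`measurable_indicator_starDeriv_translate_slidHull_comp`).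
[cite: LawlerSchrammWerner2003Restriction, §8.4 (h_t(O_t) in M_t)] -/
theorem measurable_indicator_re_starMap_slidHull_comp (hc : ∀ ω, Continuous (W ω)) (hW0 : ∀ ω, W ω 0 = 0)
    (hmeas : ∀ s, s ≤ t → Measurable fun ω ↦ W ω s) (hA : IsPlusHull A) (hne : A.Nonempty)
    {o : Ω → ℝ} (ho : Measurable o) (ho0 : ∀ ω, o ω ≤ 0) :
    Measurable fun ω ↦ Set.indicator {ω | Disjoint (closedHull (W ω) t) A}
      (fun ω ↦ (starMap (slidHull (W ω) A t) (o ω)).re) ω := by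
  -- the Riemann sums, with the alive indicator
  set R : ℕ → Ω → ℝ := fun n ω ↦ -∑ k ∈ Finset.range n, (0 - o ω) / n *
    Set.indicator {ω | Disjoint (closedHull (W ω) t) A}
      (fun ω ↦ starDeriv (SLEKappaRho.translate (slidHull (W ω) A t) (o ω + k * ((0 - o ω) / n)))) ω with hR
  have hRm : ∀ n, Measurable (R n) := by
    intro n
    refine (Finset.measurable_sum _ fun k hk ↦ ?_).neg
    have hkn : k < n := Finset.mem_range.1 hk
    have hn : (0 : ℝ) < n := by exact_mod_cast (Nat.zero_le k).trans_lt hkn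
    have hok : Measurable fun ω ↦ o ω + k * ((0 - o ω) / n) := by fun_prop
    have hok0 : ∀ ω, o ω + k * ((0 - o ω) / n) ≤ 0 := by
      intro ω
      have hkn' : (k : ℝ) / n ≤ 1 := by rw [div_le_one hn]; exact_mod_cast hkn.le
      have : o ω + k * ((0 - o ω) / n) = o ω * (1 - k / n) := by field_simp; ring
      rw [this]
      exact mul_nonpos_of_nonpos_of_nonneg (ho0 ω) (by linarith)
    exact ((measurable_const.sub ho).div_const _).mul
      (measurable_indicator_starDeriv_translate_slidHull_comp hc hW0 hmeas hA hne hok hok0)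
  refine measurable_of_tendsto_metrizable hRm (tendsto_pi_nhds.2 fun ω ↦ ?_)
  by_cases hω : Disjoint (closedHull (W ω) t) A
  · have hmem : ω ∈ {ω | Disjoint (closedHull (W ω) t) A} := hω
    simp only [hR, Set.indicator_of_mem hmem]
    have hB := isPlusHull_slidHull_of_disjoint (hc ω) (hW0 ω) hA hω
    have := (tendsto_riemannSum_starDeriv_translate hB (ho0 ω)).neg
    rwa [neg_neg] at this
  · have hmem : ω ∉ {ω | Disjoint (closedHull (W ω) t) A} := hω
    simp only [hR, Set.indicator_of_notMem hmem, mul_zero, Finset.sum_const_zero, neg_zero]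
    exact tendsto_const_nhds

/-! ### The second derivative `E_{B_t}''(o)`, `o ≤ 0`, as a limit of difference quotients -/

/-- **The real function `y ↦ E_B'(y)` has derivative `E_B''(x)` at every real `x ∉ B`** (`E_B'` is
holomorphic on the open symmetric domain). [folklore] -/
theorem hasDerivAt_re_deriv_starMap {B : Set ℂ} (hB : IsStarHull B) {x : ℝ} (hxB : (x : ℂ) ∉ B) :
    HasDerivAt (fun y : ℝ ↦ (deriv (starMap B) y).re) (deriv (deriv (starMap B)) x).re x := by
  have hΦ := isRestrictionMap_starRMap hB
  have hE : DifferentiableOn ℂ (starMap B) (symmDomain B) := by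
    rw [starMap_eq hB]; exact differentiableOn_hullExt hB.isBoundedHull hΦ
  have hopen := isOpen_symmDomain (B := B) hB.isBoundedHull.isClosed
  have hd : DifferentiableAt ℂ (deriv (starMap B)) x :=
    ((hE.analyticOnNhd hopen).deriv x (ofReal_mem_symmDomain_iff.2 hxB)).differentiableAt
  have h1 : HasDerivAt (fun t : ℝ ↦ deriv (starMap B) t) (deriv (deriv (starMap B)) x) x := by
    simpa using hd.hasDerivAt.comp_ofReal
  exact Complex.reCLM.hasFDerivAt.comp_hasDerivAt x h1

/-- **`(E_B'(o) − E_B'(o − hₙ))/hₙ → E_B''(o)`** along `hₙ = 1/(n+1)`, for a `+`-hull `B` and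
`o ≤ 0` (with `E_B'(y) = Φ'_{B−y}(0)` for `y ≤ 0`). [folklore] -/
theorem tendsto_slope_starDeriv_translate_left {B : Set ℂ} (hB : IsPlusHull B) {o : ℝ} (ho : o ≤ 0) :
    Tendsto (fun n : ℕ ↦ (starDeriv (SLEKappaRho.translate B o) -
        starDeriv (SLEKappaRho.translate B (o - 1 / ((n : ℝ) + 1)))) / (1 / ((n : ℝ) + 1)))
      atTop (𝓝 (deriv (deriv (starMap B)) o).re) := by
  have hder := hasDerivAt_re_deriv_starMap hB.1 (hB.ofReal_notMem_of_nonpos ho)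
  rw [hasDerivAt_iff_tendsto_slope] at hder
  -- the sequence `o − hₙ → o` within `≠ o`
  have hseq : Tendsto (fun n : ℕ ↦ o - 1 / ((n : ℝ) + 1)) atTop (𝓝[≠] o) := by
    refine tendsto_nhdsWithin_iff.2 ⟨?_, Eventually.of_forall fun n ↦ ?_⟩
    · have h := (tendsto_one_div_add_atTop_nhds_zero_nat (𝕜 := ℝ)).const_sub o
      rwa [sub_zero] at h
    · have : (0 : ℝ) < 1 / ((n : ℝ) + 1) := by positivity
      show o - 1 / ((n : ℝ) + 1) ≠ o
      linarith
  have h := hder.comp hseq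
  refine h.congr fun n ↦ ?_
  have hn : (0 : ℝ) < 1 / ((n : ℝ) + 1) := by positivity
  have e1 : starDeriv (SLEKappaRho.translate B o) = (deriv (starMap B) o).re := by
    rw [← hullDeriv_eq_starDeriv, hullDeriv_translate hB.1 (hB.ofReal_notMem_of_nonpos ho)]
  have e2 : starDeriv (SLEKappaRho.translate B (o - 1 / ((n : ℝ) + 1))) = (deriv (starMap B) ↑(o - 1 / ((n : ℝ) + 1))).re := by
    rw [← hullDeriv_eq_starDeriv, hullDeriv_translate hB.1 (hB.ofReal_notMem_of_nonpos (by linarith))]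
  rw [Function.comp_apply, slope_def_field, e1, e2]
  rw [show o - 1 / ((n : ℝ) + 1) - o = -(1 / ((n : ℝ) + 1)) by ring]
  field_simp
  ring

/-- **`ω ↦ E_{B_t(ω)}''(o(ω)) · 𝟙{alive}` is measurable for a measurable `o ≤ 0`**: the limit of
the difference quotients of the measurable `ω ↦ Φ'_{B_t(ω) − y(ω)}(0)`.
[cite: LawlerSchrammWerner2003Restriction, proof of Lemma 8.9 (h_t''(O_t))] -/
theorem measurable_indicator_re_deriv2_starMap_slidHull_comp (hc : ∀ ω, Continuous (W ω)) (hW0 : ∀ ω, W ω 0 = 0)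
    (hmeas : ∀ s, s ≤ t → Measurable fun ω ↦ W ω s) (hA : IsPlusHull A) (hne : A.Nonempty)
    {o : Ω → ℝ} (ho : Measurable o) (ho0 : ∀ ω, o ω ≤ 0) :
    Measurable fun ω ↦ Set.indicator {ω | Disjoint (closedHull (W ω) t) A}
      (fun ω ↦ (deriv (deriv (starMap (slidHull (W ω) A t))) (o ω)).re) ω := by
  set G : ℕ → Ω → ℝ := fun n ω ↦
    (Set.indicator {ω | Disjoint (closedHull (W ω) t) A}
        (fun ω ↦ starDeriv (SLEKappaRho.translate (slidHull (W ω) A t) (o ω))) ω -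
      Set.indicator {ω | Disjoint (closedHull (W ω) t) A}
        (fun ω ↦ starDeriv (SLEKappaRho.translate (slidHull (W ω) A t) (o ω - 1 / ((n : ℝ) + 1)))) ω) /
      (1 / ((n : ℝ) + 1)) with hG
  have hGm : ∀ n, Measurable (G n) := by
    intro n
    have hn : (0 : ℝ) < 1 / ((n : ℝ) + 1) := by positivity
    refine ((measurable_indicator_starDeriv_translate_slidHull_comp hc hW0 hmeas hA hne ho ho0).sub
      (measurable_indicator_starDeriv_translate_slidHull_comp hc hW0 hmeas hA hne (ho.sub_const _) fun ω ↦ ?_)).div_const _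
    linarith [ho0 ω]
  refine measurable_of_tendsto_metrizable hGm (tendsto_pi_nhds.2 fun ω ↦ ?_)
  by_cases hω : Disjoint (closedHull (W ω) t) A
  · have hmem : ω ∈ {ω | Disjoint (closedHull (W ω) t) A} := hω
    simp only [hG, Set.indicator_of_mem hmem]
    exact tendsto_slope_starDeriv_translate_left (isPlusHull_slidHull_of_disjoint (hc ω) (hW0 ω) hA hω) (ho0 ω)
  · have hmem : ω ∉ {ω | Disjoint (closedHull (W ω) t) A} := hω
    simp only [hG, Set.indicator_of_notMem hmem, sub_zero, zero_div]
    exact tendsto_const_nhds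

end Loewner

end Literature.Probability.RandomPlanarGeometry

end
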